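import Mathlib.RingTheory.Length
import Mathlib.RingTheory.AdjoinRoot
import Mathlib.RingTheory.SimpleModule.Basic
import Mathlib.FieldTheory.IsAlgClosed.Basic
import Mathlib.Algebra.Polynomial.Degree.Domain
import Mathlib.RingTheory.Int.Basic
import HarnessLib

/-!
# `ℓ`-Euclidean rings: `ℤ` is not `ℓ`-Euclidean; `k[t]` is `ℓ`-Euclidean iff `k` is algebraically closed
# (Clark 2015, §3.1–§3.2, Prop. 30 and Example 3.1)

Topic `Literature/Algebra/EuclideanDomain`, namespace `Literature.Algebra.EuclideanDomain`.  THEOREMS ONLY (no `def`, no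
instance, no named fact), all proved, in Mathlib's vocabulary: Clark's `ℓ(x) = len(R/(x))` is `Module.length R (R ⧸ Ideal.span {x})`
(the length of the ring `R/(x)`, an element of `ℕ∞`, which for `x ≠ 0` in a PID is the finite number of prime factors of `x`),
and Clark's «Euclidean function» `φ : R• → Ord` («for all `a ∈ R`, `b ∈ R•`, there are `q, r ∈ R` with `a = qb + r` and (`r = 0`
or `φ(r) < φ(b)`)», §2) is written, as in `MotzkinConstruction.lean` / `ArtinianPrincipalRingsEuclidean.lean`, as
`∀ a b, b ≠ 0 → ∃ q r, a = b * q + r ∧ (r = 0 ∨ φ r < φ b)` (the value of `φ` at `0` is never used).  So «`R` is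
`ℓ`-Euclidean» is the latter with `φ = ℓ`, spelled out in each statement (no new definition).

## Source (read at the page)

P. L. Clark, *A note on Euclidean order types*, Order **32** (2015) 157–178 [Clark2015EuclideanOrderTypes] (materialised
`paper:arxiv-1208.0977`, arXiv numbering; `p0007.txt`), VERBATIM.  §3.1: «Henceforth we suppose `R` is Noetherian, so `𝓘^∨(R)` is
Artinian with top element `(0)`. By the results of §1 there is a least isotone map `λ_R : 𝓘^∨(R) → Ord`, the length function `λ_R` of
`R`, and we define the length of `R` as `len(R) = λ_R((0))`. … and thus also `len(R/I) = λ_{R/I}((0)) = λ_R(q^*((0))) = λ_R(I)`.  To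
ease notation, for `x ∈ R` we put `ℓ(x) = λ_R((x))`.»  «**Proposition 29.** Let `φ` be a Euclidean function on `R`. For all `x ∈ R`,
`ℓ(x) ≤ φ(x)`.»  «If `R` is a PID and `x ∈ R•`, then the ring `R/(x)` is an Artinian ring and thus its length, which is equal
to `ℓ(x)`, is finite. In particular, for all `x ∈ R•` `ℓ(x) < ω` and `ℓ(0) = ω`. From this the next result follows directly.
**Proposition 30.** Let `R` be a PID which is not a field, and let `x ∈ R`. a) If `x ∈ R×`, then `ℓ(x) = 0`. b) If
`x ∈ R• ∖ R×`, we may write `x = π₁ ⋯ π_n` for not necessarily distinct prime elements `π₁, …, π_n`, and then `ℓ(x) = n`. c) We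
have `ℓ(0) = len(R) = ω`.»  §3.2: «A ring `R` is `ℓ`-Euclidean if the function `x ∈ R ↦ ℓ(x) ∈ Ord•` is a Euclidean function
on `R`. The point is that if `ℓ` is a Euclidean function on `R`, it is then the least Euclidean function on `R`, so that
`e(R) = len(R)`.  **Example 3.1:** a) The ring `ℤ` is not `ℓ`-Euclidean. b) For a field `k`, the ring `k[t]` is `ℓ`-Euclidean iff
`k` is algebraically closed.»  (§2, p0004: «A Euclidean function is a function `φ : R• → Ord` such that for all `a ∈ R`, `b ∈ R•`,
there are `q, r ∈ R` with `a = qb + r` and (`r = 0` or `φ(r) < φ(b)`).»)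

## What is formalised

* §1 (Prop. 30 (a) and the prime case of (b), any commutative ring) `length_quotient_span_eq_zero_iff` (`ℓ(x) = 0 ⟺ x` a unit),
  `length_quotient_eq_one_of_isMaximal` / `length_quotient_span_eq_one_of_irreducible` (`ℓ(π) = 1` for a prime `π` of a PID).
* §2 **Example 3.1 a): `ℤ` is not `ℓ`-Euclidean** (`Int.not_lengthEuclidean`: `a = 2`, `b = 5` — `ℓ(5) = 1`, and no
  `r ≡ 2 (mod 5)` is `0` or a unit).
* §3 (Prop. 30 (b) for `k[t]`) `Polynomial.length_quotient_span_le_natDegree` (`ℓ(f) ≤ deg f` over any field: a chain of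
  `k[t]`-submodules of `k[t]/(f)` is a chain of `k`-subspaces, `dim_k k[t]/(f) = deg f`), and over an algebraically closed field
  `Polynomial.natDegree_le_length_quotient_span` (`deg f ≤ ℓ(f)`: split off a root, `(f) ⊊ (f/(t − a))`) hence
  `Polynomial.length_quotient_span_eq_natDegree` (`ℓ(f) = deg f = n`, the number of prime factors).
* §4 **Example 3.1 b): `k[t]` is `ℓ`-Euclidean iff `k` is algebraically closed** (`Polynomial.lengthEuclidean_iff_isAlgClosed`:
  `⇐` divide with remainder, `ℓ(r) ≤ deg r < deg b ≤ ℓ(b)`; `⇒` for a monic irreducible `p`, dividing `t` by `p` leaves `r = 0` or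
  a unit `c`, so `p ∣ t − c`, `deg p = 1`, `p` has a root).
-- TODO(general form): Prop. 29 (`ℓ(x) ≤ φ(x)` for every Euclidean function, via the least isotone map of §1), Prop. 30 (b) for a
-- general PID (`ℓ(x)` = number of prime factors) and (c), Prop. 31 (localizations) are not formalised here.

## Mathlib / tree search

Mathlib: `Module.length`, `Module.length_eq_zero_iff`, `Module.length_eq_one_iff`, `Module.length_quotient` (`= Order.coheight`),
`Order.coheight_add_one_le`, `Submodule.length_le_length_restrictScalars`, `Module.length_eq_finrank`,
`finrank_quotient_span_eq_natDegree`, `AdjoinRoot.powerBasis`, `isSimpleModule_iff_isCoatom`, `Ideal.span_singleton_lt_span_singleton`,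
`IsAlgClosed.exists_root`, `IsAlgClosed.of_exists_root`, `Polynomial.mul_divByMonic_eq_iff_isRoot`, `EuclideanDomain.div_add_mod`,
`EuclideanDomain.mod_lt`; no notion of `ℓ`-Euclidean ring (`lean search 'Euclidean.*length|length.*Euclidean'` → nothing).  Tree:
the Euclidean-function FORM is the one of `MotzkinConstruction.lean` (`exists_euclideanFunction_iff_…`) and
`ArtinianPrincipalRingsEuclidean.lean`; lengths of principal ideal rings over themselves are
`Literature/RingTheory/PrincipalIdealRing/LengthOfPrincipalIdealRings.lean` (not needed here).
-/

namespace Literature.Algebra.EuclideanDomain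

open Polynomial

universe u

/-! ## §1 `ℓ(x) = 0 ⟺ x` is a unit; `ℓ(π) = 1` for a prime `π` -/

section Basic

variable {R : Type u} [CommRing R]

/-- **Prop. 30 a)** «If `x ∈ R×`, then `ℓ(x) = 0`» — and conversely: `ℓ(x) = len(R/(x)) = 0` iff `R/(x) = 0` iff `x` is a unit
(any commutative ring). [cite: Clark2015EuclideanOrderTypes, Prop. 30 (a)] -/
theorem length_quotient_span_eq_zero_iff {x : R} : Module.length R (R ⧸ Ideal.span {x}) = 0 ↔ IsUnit x := by
  rw [Module.length_eq_zero_iff, Ideal.Quotient.subsingleton_iff, Ideal.span_singleton_eq_top]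

/-- `len(R/𝔪) = 1` for a maximal ideal `𝔪` (`R/𝔪` is a field, a simple `R`-module). [cite: Clark2015EuclideanOrderTypes, §3.1
(`len(R/I) = λ_R(I)`) and Prop. 30 (b) with `n = 1`] -/
theorem length_quotient_eq_one_of_isMaximal {I : Ideal R} (hI : I.IsMaximal) : Module.length R (R ⧸ I) = 1 := by
  rw [Module.length_eq_one_iff]
  exact isSimpleModule_iff_isCoatom.2 (Ideal.isMaximal_def.1 hI)

/-- **Prop. 30 b), `n = 1`: `ℓ(π) = 1` for a prime (irreducible) element `π` of a principal ideal domain** (`(π)` is maximal).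
[cite: Clark2015EuclideanOrderTypes, Prop. 30 (b)] -/
theorem length_quotient_span_eq_one_of_irreducible [IsDomain R] [IsPrincipalIdealRing R] {p : R} (hp : Irreducible p) :
    Module.length R (R ⧸ Ideal.span {p}) = 1 :=
  length_quotient_eq_one_of_isMaximal (PrincipalIdealRing.isMaximal_of_irreducible hp)

/-- If `ℓ(r) < ℓ(b)` with `(b)` maximal then `r` is a unit (`ℓ(b) = 1` forces `ℓ(r) = 0`). [cite: Clark2015EuclideanOrderTypes,
Prop. 30 (a), (b)] -/
theorem isUnit_of_length_quotient_span_lt {r b : R} (hb : (Ideal.span {b}).IsMaximal)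
    (h : Module.length R (R ⧸ Ideal.span {r}) < Module.length R (R ⧸ Ideal.span {b})) : IsUnit r := by
  rw [length_quotient_eq_one_of_isMaximal hb, Order.lt_one_iff] at h
  exact length_quotient_span_eq_zero_iff.1 h

end Basic

/-! ## §2 Example 3.1 a): `ℤ` is not `ℓ`-Euclidean -/

section Integers

/-- **Example 3.1 a) «The ring `ℤ` is not `ℓ`-Euclidean»**: `ℓ(n)` = number of prime factors of `n` is not a Euclidean function
— dividing `2` by `5`, every remainder `r ≡ 2 (mod 5)` is neither `0` nor a unit, so `ℓ(r) ≥ 1 = ℓ(5)`.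
[cite: Clark2015EuclideanOrderTypes, Example 3.1 (a)] -/
theorem Int.not_lengthEuclidean :
    ¬ ∀ a b : ℤ, b ≠ 0 → ∃ q r : ℤ, a = b * q + r ∧
      (r = 0 ∨ Module.length ℤ (ℤ ⧸ Ideal.span {r}) < Module.length ℤ (ℤ ⧸ Ideal.span {b})) := by
  intro h
  obtain ⟨q, r, hqr, hr⟩ := h 2 5 (by norm_num)
  have hp5 : Prime (5 : ℤ) := Int.prime_iff_natAbs_prime.2 Nat.prime_five
  have h5 : (Ideal.span {(5 : ℤ)}).IsMaximal := PrincipalIdealRing.isMaximal_of_irreducible hp5.irreducible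
  rcases hr with rfl | hr
  · omega
  · rcases Int.isUnit_iff.1 (isUnit_of_length_quotient_span_lt h5 hr) with rfl | rfl <;> omega

/-- … although `ℤ` is Euclidean (for `|·|`): being `ℓ`-Euclidean is strictly stronger. [cite: Clark2015EuclideanOrderTypes,
Example 3.1 (a) and Example 2.1 («`n ↦ |n|` is a Euclidean function»)] -/
theorem Int.absEuclidean_and_not_lengthEuclidean :
    (∀ a b : ℤ, b ≠ 0 → ∃ q r : ℤ, a = b * q + r ∧ (r = 0 ∨ r.natAbs < b.natAbs)) ∧
      ¬ ∀ a b : ℤ, b ≠ 0 → ∃ q r : ℤ, a = b * q + r ∧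
        (r = 0 ∨ Module.length ℤ (ℤ ⧸ Ideal.span {r}) < Module.length ℤ (ℤ ⧸ Ideal.span {b})) := by
  refine ⟨fun a b hb ↦ ⟨a / b, a % b, (Int.mul_ediv_add_emod a b).symm, Or.inr ?_⟩, Int.not_lengthEuclidean⟩
  have h₁ : 0 ≤ a % b := Int.emod_nonneg a hb
  have h₂ : a % b < |b| := Int.emod_lt_abs a hb
  rw [Int.abs_eq_natAbs] at h₂
  omega

end Integers

/-! ## §3 Prop. 30 b) for `k[t]`: `ℓ(f) ≤ deg f`, with equality over an algebraically closed field -/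

section Polynomials

variable {k : Type u} [Field k]

/-- **`ℓ(f) ≤ deg f`** for `f ≠ 0` in `k[t]`, `k` any field: a chain of ideals of `k[t]/(f)` is a chain of `k`-subspaces, and
`dim_k k[t]/(f) = deg f` (`ℓ(x)` «is finite» for `x ∈ R•`). [cite: Clark2015EuclideanOrderTypes, §3.1 (before Prop. 30) and
Prop. 30 (b)] -/
theorem Polynomial.length_quotient_span_le_natDegree {f : k[X]} (hf : f ≠ 0) :
    Module.length k[X] (k[X] ⧸ Ideal.span {f}) ≤ f.natDegree := by
  haveI : Module.Finite k (k[X] ⧸ Ideal.span {f}) := (AdjoinRoot.powerBasis hf).finite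
  calc Module.length k[X] (k[X] ⧸ Ideal.span {f})
      = Module.length k[X] (⊤ : Submodule k[X] (k[X] ⧸ Ideal.span {f})) := Module.length_top.symm
    _ ≤ Module.length k ((⊤ : Submodule k[X] (k[X] ⧸ Ideal.span {f})).restrictScalars k) :=
        Submodule.length_le_length_restrictScalars k ⊤
    _ = Module.length k (k[X] ⧸ Ideal.span {f}) := by rw [Submodule.restrictScalars_top, Module.length_top]
    _ = (f.natDegree : ℕ∞) := by rw [Module.length_eq_finrank, finrank_quotient_span_eq_natDegree]

/-- **`deg f ≤ ℓ(f)`** for `f ≠ 0` in `k[t]`, `k` algebraically closed: `f = (t − a)·g` and `(f) ⊊ (g)`, so `ℓ(f) ≥ ℓ(g) + 1`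
(induction on the degree; «`x = π₁ ⋯ π_n` … `ℓ(x) = n`», all primes being linear).
[cite: Clark2015EuclideanOrderTypes, Prop. 30 (b) and Example 3.1 (b)] -/
theorem Polynomial.natDegree_le_length_quotient_span [IsAlgClosed k] {f : k[X]} (hf : f ≠ 0) :
    (f.natDegree : ℕ∞) ≤ Module.length k[X] (k[X] ⧸ Ideal.span {f}) := by
  induction hn : f.natDegree generalizing f with
  | zero => exact bot_le
  | succ n ih =>
    -- split off a root: `f = (X - C a) * g`
    have hd : f.degree ≠ 0 := fun h ↦ by
      rw [Polynomial.degree_eq_natDegree hf, hn] at h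
      exact absurd h (by exact_mod_cast Nat.succ_ne_zero n)
    obtain ⟨a, ha⟩ := IsAlgClosed.exists_root f hd
    set g := f /ₘ (X - C a) with hg
    have hfg : f = (X - C a) * g := (mul_divByMonic_eq_iff_isRoot.2 ha).symm
    have hg0 : g ≠ 0 := fun h ↦ hf (by rw [hfg, h, mul_zero])
    have hgn : g.natDegree = n := by
      have h := congrArg natDegree hfg
      rw [natDegree_mul (X_sub_C_ne_zero a) hg0, natDegree_X_sub_C] at h
      omega
    have ih' := ih hg0 hgn
    -- `(f) ⊊ (g)`, so the length goes up by one
    have hlt : (Ideal.span {f} : Ideal k[X]) < Ideal.span {g} :=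
      Ideal.span_singleton_lt_span_singleton.2 ⟨hg0, X - C a, not_isUnit_X_sub_C a, by rw [hfg, mul_comm]⟩
    rw [Module.length_quotient] at ih' ⊢
    calc ((n + 1 : ℕ) : ℕ∞) = (n : ℕ∞) + 1 := by push_cast; rfl
      _ ≤ Order.coheight (Ideal.span {g} : Ideal k[X]) + 1 := add_le_add ih' le_rfl
      _ ≤ Order.coheight (Ideal.span {f} : Ideal k[X]) := Order.coheight_add_one_le hlt

/-- **Prop. 30 b) for `k[t]`, `k` algebraically closed: `ℓ(f) = deg f`** (`= n`, the number of — linear — prime factors of `f`).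
[cite: Clark2015EuclideanOrderTypes, Prop. 30 (b) and Example 3.1 (b)] -/
theorem Polynomial.length_quotient_span_eq_natDegree [IsAlgClosed k] {f : k[X]} (hf : f ≠ 0) :
    Module.length k[X] (k[X] ⧸ Ideal.span {f}) = f.natDegree :=
  le_antisymm (Polynomial.length_quotient_span_le_natDegree hf) (Polynomial.natDegree_le_length_quotient_span hf)

end Polynomials

/-! ## §4 Example 3.1 b): `k[t]` is `ℓ`-Euclidean iff `k` is algebraically closed -/

section PolynomialsEuclidean

variable (k : Type u) [Field k]

/-- If `k[t]` is `ℓ`-Euclidean then every monic irreducible `p` has a root: dividing `t` by `p` leaves a remainder `r` with `r = 0`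
or `ℓ(r) < ℓ(p) = 1`, i.e. `r` a unit `c`; either way `p ∣ t − c`, so `deg p = 1`. [cite: Clark2015EuclideanOrderTypes,
Example 3.1 (b)] -/
theorem Polynomial.isAlgClosed_of_lengthEuclidean
    (h : ∀ a b : k[X], b ≠ 0 → ∃ q r : k[X], a = b * q + r ∧
      (r = 0 ∨ Module.length k[X] (k[X] ⧸ Ideal.span {r}) < Module.length k[X] (k[X] ⧸ Ideal.span {b}))) :
    IsAlgClosed k := by
  refine IsAlgClosed.of_exists_root k fun p _ hirr ↦ ?_
  obtain ⟨q, r, hqr, hr⟩ := h X p hirr.ne_zero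
  -- in both cases `p ∣ X - C c` for some constant `c`
  have hdvd : ∃ c : k, p ∣ X - C c := by
    rcases hr with rfl | hr
    · exact ⟨0, q, by rw [map_zero, sub_zero, hqr, add_zero]⟩
    · obtain ⟨c, -, hc⟩ := Polynomial.isUnit_iff.1
        (isUnit_of_length_quotient_span_lt (PrincipalIdealRing.isMaximal_of_irreducible hirr) hr)
      exact ⟨c, q, by rw [hc, hqr, add_sub_cancel_right]⟩
  obtain ⟨c, hc⟩ := hdvd
  have h1 : p.natDegree = 1 :=
    le_antisymm ((natDegree_le_of_dvd hc (X_sub_C_ne_zero c)).trans_eq (natDegree_X_sub_C c))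
      (Polynomial.natDegree_pos_iff_degree_pos.2 (degree_pos_of_irreducible hirr))
  obtain ⟨x, hx⟩ := exists_root_of_degree_eq_one ((degree_eq_iff_natDegree_eq hirr.ne_zero).2 h1)
  exact ⟨x, hx⟩

/-- If `k` is algebraically closed then `k[t]` is `ℓ`-Euclidean: divide with remainder, `deg r < deg b`, and
`ℓ(r) ≤ deg r < deg b = ℓ(b)`. [cite: Clark2015EuclideanOrderTypes, Example 3.1 (b)] -/
theorem Polynomial.lengthEuclidean_of_isAlgClosed [IsAlgClosed k] :
    ∀ a b : k[X], b ≠ 0 → ∃ q r : k[X], a = b * q + r ∧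
      (r = 0 ∨ Module.length k[X] (k[X] ⧸ Ideal.span {r}) < Module.length k[X] (k[X] ⧸ Ideal.span {b})) := by
  intro a b hb
  refine ⟨a / b, a % b, (EuclideanDomain.div_add_mod a b).symm, ?_⟩
  rcases eq_or_ne (a % b) 0 with h0 | h0
  · exact Or.inl h0
  · refine Or.inr ?_
    have hdeg : (a % b).degree < b.degree := EuclideanDomain.mod_lt a hb
    have hnat : (a % b).natDegree < b.natDegree := natDegree_lt_natDegree h0 hdeg
    calc Module.length k[X] (k[X] ⧸ Ideal.span {a % b})
        ≤ (a % b).natDegree := Polynomial.length_quotient_span_le_natDegree h0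
      _ < (b.natDegree : ℕ∞) := by exact_mod_cast hnat
      _ ≤ Module.length k[X] (k[X] ⧸ Ideal.span {b}) := Polynomial.natDegree_le_length_quotient_span hb

/-- **Example 3.1 b) «For a field `k`, the ring `k[t]` is `ℓ`-Euclidean iff `k` is algebraically closed.»**
[cite: Clark2015EuclideanOrderTypes, Example 3.1 (b)] -/
theorem Polynomial.lengthEuclidean_iff_isAlgClosed :
    (∀ a b : k[X], b ≠ 0 → ∃ q r : k[X], a = b * q + r ∧
      (r = 0 ∨ Module.length k[X] (k[X] ⧸ Ideal.span {r}) < Module.length k[X] (k[X] ⧸ Ideal.span {b}))) ↔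
      IsAlgClosed k :=
  ⟨Polynomial.isAlgClosed_of_lengthEuclidean k, fun _ ↦ Polynomial.lengthEuclidean_of_isAlgClosed k⟩

/-- In particular `ℚ[t]` (like `ℤ`) is Euclidean but not `ℓ`-Euclidean: `t² + 1`… — stated for any field that is not
algebraically closed. [cite: Clark2015EuclideanOrderTypes, Example 3.1 (b)] -/
theorem Polynomial.not_lengthEuclidean_of_not_isAlgClosed (hk : ¬ IsAlgClosed k) :
    ¬ ∀ a b : k[X], b ≠ 0 → ∃ q r : k[X], a = b * q + r ∧
      (r = 0 ∨ Module.length k[X] (k[X] ⧸ Ideal.span {r}) < Module.length k[X] (k[X] ⧸ Ideal.span {b})) :=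
  fun h ↦ hk (Polynomial.isAlgClosed_of_lengthEuclidean k h)

end PolynomialsEuclidean

end Literature.Algebra.EuclideanDomain
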